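import Literature.AlgebraicGeometry.HodgeTheory.CorrespondenceComposition
import HarnessLib

/-!
# Cup products of pulled-back cross products on `X ⊗ (Y ⊗ Z)`: the identities behind the composition of correspondences

Family `hodge`, layer `Literature/AlgebraicGeometry/HodgeTheory`. Companion of
`CorrespondenceComposition` (Fulton Def. 16.1.1, `β ∘ α = p₁₃*(p₁₂^*α · p₂₃^*β)`; Buskin Lemma 6.3)
recording, for the partial projections `p₁₂ = X ◁ pr_Y : X ⊗ (Y ⊗ Z) → X ⊗ Y` and
`p₂₃ = pr_{Y ⊗ Z}`, the elementary identities of the cohomology ring used when the two factors are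
CROSS PRODUCTS (W. Fulton, *Young Tableaux*, App. B §B.1 (3): `∪` is associative, graded
commutative and natural):

* `cup_map_whiskerLeft_fst_cross_map_snd_cross` —
  `p₁₂^*(pr_X^* a ∪ pr_Y^* c) ∪ p₂₃^*(pr_Y^* c' ∪ pr_Z^* e) = pr_X^* a ∪ pr_{Y⊗Z}^*(pr_Y^*(c ∪ c') ∪ pr_Z^* e)`
  (all degrees): the middle factor only sees `c ∪ c'`;
* `cup_cross_map_snd` — `(pr_X^* a ∪ pr_Y^* c) ∪ pr_Y^* ψ = pr_X^* a ∪ pr_Y^*(c ∪ ψ)` on `X ⊗ Y`;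
* `map_fst_cup_cross` — `pr_X^* ψ ∪ (pr_X^* c ∪ pr_Y^* e) = pr_X^*(ψ ∪ c) ∪ pr_Y^* e` on `X ⊗ Y`.

Everything is proved (associativity `cupProduct_assoc`, naturality `cupProduct_map`,
`X ◁ pr_Y ≫ pr_X = pr_X`, `X ◁ pr_Y ≫ pr_Y = pr_{Y⊗Z} ≫ pr_Y`); no named facts, no definitions.

## References

* [FultonYoungTableaux1997] W. Fulton, Young Tableaux, CUP 1997, Appendix B §B.1 (1)–(3).
* [Fulton1998] W. Fulton, Intersection Theory, 2nd ed. 1998, §16.1 Def. 16.1.1.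
* [HatcherAT2002] A. Hatcher, Algebraic Topology, CUP 2002, §3.2 Prop. 3.10 and p. 211.
-/

noncomputable section

open CategoryTheory AlgebraicGeometry MonoidalCategory CartesianMonoidalCategory
open Literature.AlgebraicGeometry.Motives
open Literature.AlgebraicTopology.SingularHomology

namespace Literature.AlgebraicGeometry.HodgeTheory

section HodgeTheory

variable {X Y Z : SchemeOver ℂ}

/-- Pull-back is multiplicative: `f^*(a ∪ b) = f^* a ∪ f^* b` for `complexBetti.map`
(Hatcher Prop. 3.10, the tree's `cupProduct_map`). [cite: HatcherAT2002, §3.2 Prop. 3.10] -/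
theorem complexBetti.map_cupProduct {X' : SchemeOver ℂ} (f : X' ⟶ X) {p q n : ℕ} (h : p + q = n)
    (a : complexBetti X p) (b : complexBetti X q) :
    complexBetti.map f n (cupProduct h a b) =
      cupProduct h (complexBetti.map f p a) (complexBetti.map f q b) :=
  cupProduct_map _ h a b

/-- `(g ≫ h)^* a = g^* (h^* a)` on elements. [cite: FultonYoungTableaux1997, Appendix B §B.1 (1)] -/
theorem complexBetti.map_comp_apply' {X' : SchemeOver ℂ} (g : X' ⟶ X) (h : X ⟶ Y) (i : ℕ)
    (a : complexBetti Y i) :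
    complexBetti.map (g ≫ h) i a = complexBetti.map g i (complexBetti.map h i a) := by
  rw [complexBetti.map_comp, ModuleCat.comp_apply]

variable (X) in
/-- `p₁₂^* pr_X^* a = pr_X^* a` on `X ⊗ (Y ⊗ Z)` (`X ◁ pr_Y ≫ pr_X = pr_X`).
[cite: FultonYoungTableaux1997, Appendix B §B.1 (1)] -/
theorem map_whiskerLeft_fst_map_fst {i : ℕ} (a : complexBetti X i) :
    complexBetti.map (X ◁ fst Y Z) i (complexBetti.map (fst X Y) i a) =
      complexBetti.map (fst X (Y ⊗ Z)) i a := by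
  rw [← complexBetti.map_comp_apply', whiskerLeft_fst]

variable (X) in
/-- `p₁₂^* pr_Y^* c = p₂₃^* pr_Y^* c` on `X ⊗ (Y ⊗ Z)` (`X ◁ pr_Y ≫ pr_Y = pr_{Y⊗Z} ≫ pr_Y`).
[cite: FultonYoungTableaux1997, Appendix B §B.1 (1)] -/
theorem map_whiskerLeft_fst_map_snd {j : ℕ} (c : complexBetti Y j) :
    complexBetti.map (X ◁ fst Y Z) j (complexBetti.map (snd X Y) j c) =
      complexBetti.map (snd X (Y ⊗ Z)) j (complexBetti.map (fst Y Z) j c) := by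
  rw [← complexBetti.map_comp_apply', whiskerLeft_snd, complexBetti.map_comp_apply']

variable (X Y Z) in
/-- **The middle factor only sees `c ∪ c'`**:
`p₁₂^*(pr_X^* a ∪ pr_Y^* c) ∪ p₂₃^*(pr_Y^* c' ∪ pr_Z^* e) = pr_X^* a ∪ pr_{Y⊗Z}^*(pr_Y^*(c ∪ c') ∪ pr_Z^* e)`
on `X ⊗ (Y ⊗ Z)`, for classes `a, c, c', e` of `X(ℂ), Y(ℂ), Y(ℂ), Z(ℂ)` of any degrees
(associativity and naturality of `∪`; the composition shape of Fulton Def. 16.1.1 on cross products).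
[cite: FultonYoungTableaux1997, Appendix B §B.1 (1)–(3)] [cite: Fulton1998, §16.1 Def. 16.1.1] -/
theorem cup_map_whiskerLeft_fst_cross_map_snd_cross {i j i' j' s s' tot jj r₂ : ℕ}
    (hij : i + j = s) (hi'j' : i' + j' = s') (hss' : s + s' = tot) (hjj : j + i' = jj)
    (h₂ : jj + j' = r₂) (h₃ : i + r₂ = tot)
    (a : complexBetti X i) (c : complexBetti Y j) (c' : complexBetti Y i') (e : complexBetti Z j') :
    cupProduct hss'
        (complexBetti.map (X ◁ fst Y Z) s
          (cupProduct hij (complexBetti.map (fst X Y) i a) (complexBetti.map (snd X Y) j c)))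
        (complexBetti.map (snd X (Y ⊗ Z)) s'
          (cupProduct hi'j' (complexBetti.map (fst Y Z) i' c') (complexBetti.map (snd Y Z) j' e))) =
      cupProduct h₃ (complexBetti.map (fst X (Y ⊗ Z)) i a)
        (complexBetti.map (snd X (Y ⊗ Z)) r₂
          (cupProduct h₂ (complexBetti.map (fst Y Z) jj (cupProduct hjj c c'))
            (complexBetti.map (snd Y Z) j' e))) := by
  -- expand the pull-backs of the cross products
  simp only [complexBetti.map_cupProduct, map_whiskerLeft_fst_map_fst, map_whiskerLeft_fst_map_snd]
  -- `(F a ∪ G c) ∪ (G c' ∪ H e) = F a ∪ (G c ∪ (G c' ∪ H e)) = F a ∪ ((G c ∪ G c') ∪ H e)`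
  rw [cupProduct_assoc hij (show j + s' = r₂ by omega) hss' h₃,
    ← cupProduct_assoc hjj hi'j' h₂ (show j + s' = r₂ by omega)]

/-- **`(pr_X^* a ∪ pr_Y^* c) ∪ pr_Y^* ψ = pr_X^* a ∪ pr_Y^*(c ∪ ψ)`** on `X ⊗ Y` (associativity and
naturality). [cite: FultonYoungTableaux1997, Appendix B §B.1 (1)–(3)] -/
theorem cup_cross_map_snd {i j k s t jk : ℕ} (hij : i + j = s) (hst : s + k = t) (hjk : j + k = jk)
    (ht : i + jk = t) (a : complexBetti X i) (c : complexBetti Y j) (ψ : complexBetti Y k) :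
    cupProduct hst (cupProduct hij (complexBetti.map (fst X Y) i a) (complexBetti.map (snd X Y) j c))
        (complexBetti.map (snd X Y) k ψ) =
      cupProduct ht (complexBetti.map (fst X Y) i a)
        (complexBetti.map (snd X Y) jk (cupProduct hjk c ψ)) := by
  rw [cupProduct_assoc hij hjk hst ht, complexBetti.map_cupProduct]

/-- **`pr_X^* ψ ∪ (pr_X^* c ∪ pr_Y^* e) = pr_X^*(ψ ∪ c) ∪ pr_Y^* e`** on `X ⊗ Y` (associativity and
naturality). [cite: FultonYoungTableaux1997, Appendix B §B.1 (1)–(3)] -/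
theorem map_fst_cup_cross {k i j s t ki : ℕ} (hij : i + j = s) (hkt : k + s = t) (hki : k + i = ki)
    (ht : ki + j = t) (ψ : complexBetti X k) (c : complexBetti X i) (e : complexBetti Y j) :
    cupProduct hkt (complexBetti.map (fst X Y) k ψ)
        (cupProduct hij (complexBetti.map (fst X Y) i c) (complexBetti.map (snd X Y) j e)) =
      cupProduct ht (complexBetti.map (fst X Y) ki (cupProduct hki ψ c))
        (complexBetti.map (snd X Y) j e) := by
  rw [← cupProduct_assoc hki hij ht hkt, complexBetti.map_cupProduct]

end HodgeTheory

end Literature.AlgebraicGeometry.HodgeTheory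

end
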